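import Literature.Probability.RandomPlanarGeometry.HexSAWRotStripIdentityY
import Literature.Probability.RandomPlanarGeometry.HexSAWRotStripArchCut
import Literature.Probability.RandomPlanarGeometry.HexSAWRotStripLateralNull
import Literature.Probability.RandomPlanarGeometry.HexSAWRotStripSurfaceZigzag
import Literature.Probability.RandomPlanarGeometry.HexSAWRotStripLogDecay
import Mathlib.Analysis.SpecialFunctions.Pow.Real
import HarnessLib

/-!
# The critical surface fugacity of rotated-honeycomb SAW at the strip level: Beaton 2014, Lemma 12 + Proposition 11, and `y_H → y†` — ALL UNCONDITIONAL
(CAPSTONE-ROT ed.3 = train item ⑨ `HexSAWRotSurfaceFugacity.lean`; a-idea-1 g17, HOME text over the tree / lane vocabulary)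

Topic `Literature/Probability/RandomPlanarGeometry`.  Source: N. R. Beaton, *The critical surface fugacity of self-avoiding walks on a
rotated honeycomb lattice*, J. Phys. A 47 (2014) 075003, arXiv:1210.0274v3 — §4: Lemma 12 (p. 16: for `0 < y < y†`, `B_T(x_c, y)` is
finite, uniformly in the width), Proposition 11 (statement p. 17) with its proof (p. 18, Fig. 7: for `y > y†`, `B_T(x_c, y) = ∞` for all large `T`),
`y† = √((2+√2)/(1+√2−√(2+√2)))` (Theorem 1, p. 2).  Vocabulary: a-p2 g7's K96.1 `HV.rotGFy` / `HV.topContacts` / `HV.rotYdagger`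
(`HexSAWRotStripIdentityY`), the tree's `HV.rotStripV` / `HV.rotGF` / `HV.rotStripBR` (`HexSAWRotStripClasses`, `…Dictionary`, `…Limit`,
`…LogDecay`), a-p6 g7's `HV.rot_arch_cut_iSup` (`HexSAWRotStripArchCut`) and `HV.tendsto_rotStripLat_zero`, `HV.iSup_rotStripBR_pos`
(`HexSAWRotStripLateralNull`), a-p2 g7's face UB `HV.RotByUnboundedLarge` / `HV.rotByUnboundedLarge_holds` (`HexSAWRotStripSurfaceZigzag`,
zig-zag top walks, `2 ≤ H`).

What is proved here (strip level; the identification with the printed strip radius `y_T` (Props 8–10, Cor. 10) and with `y_c(κ)` is NOT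
formalised — label of record lit-1 (C) 2026-08-23), WITH NO HYPOTHESIS:
* `rotTop_bddAbove_of_lt` — Lemma 12: for `0 < y < y†` and every `H ≥ 1`, `W ↦ B^{→}_{H,W+1}(x_c; y)` is bounded (a-p2's `rotGFy_top_le`).
* `rotStripByUnbounded_holds` / `rotTop_not_bddAbove_of_gt` — Proposition 11: for `y > y†` there is `H₀` with `W ↦ B^{→}_{H,W+1}(x_c; y)`
  unbounded for every `H ≥ H₀`.  Inputs BY NAME: Y1 `rotStrip_identityY` (a-p2; Beaton Prop. 6 at n = 0, parity `H + W` odd), the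
  `y = 1` identity `rotStrip_identity` (tree), Y2 `rot_arch_cut_iSup` (a-p6; the last-contact cut of Beaton p. 17, constant `x_c⁻¹`),
  S0 `iSup_rotStripBR_pos` (a-p6), T3 `iSup_rotStripBR_le_log` (tree; `sup_W B^{→}_{H,W}(x_c) ≤ C (log H)^{−1/3}`), `tendsto_rotStripBR`
  (tree), the sign of `c_B(y)` (`rotB_coeff_eq`, `rotB_coeff_pos_iff`, a-p2), and — replacing Beaton's use of the strip radius `y_T`
  (Cor. 10/13: `E_T(x_c, y) = 0` below `y_T`) — the LANE'S INTERPOLATION LEMMA `tendsto_rotLat_of_top_bdd`: if `W ↦ B^{→}_{H,W}(x_c; y)`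
  is bounded then for every `0 ≤ t < y` the lateral class `E^{⊥}_{H,W}(x_c; t) → 0` along the odd widths, because
  `E(t) ≤ max(1,t)^{m₀} E(1) + (t/y)^{m₀} E(y)` (split at `m₀` top contacts; `rotGFy_le_split`), `E(1) → 0` (a-p6's
  `tendsto_rotStripLat_zero`, y = 1) and `E(y)` is bounded by the identity Y1 when `B(y)` is.  Beaton's contradiction is then run at
  the midpoint `t = (y† + y)/2` (boundedness at `y` ⇒ at `t`, by monotonicity in `y`).  NO slab / strip-radius input is used.
* the lane thresholds `rotYT H := sSup {y ≥ 0 | W ↦ B^{→}_{H,W+1}(x_c; y) bounded}` and the capstone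
  `tendsto_rotYT : Tendsto rotYT atTop (𝓝 rotYdagger)` — using a-p2's face UB `rotByUnboundedLarge_holds` (for `H ≥ 2`, above
  `2 + √2 = x_c⁻²` the top class is unbounded: zig-zag top walks, Beaton Prop. 7 «κ(y) ≥ √y»; at `H = 1` the top row is a row of
  disconnected dimers and `B^{→}_{1,W} = x_c² y + x_c³ y²` is bounded — a-p2's refute-first catch E-UB-H1, lead r53 (2)).
-/

noncomputable section

open Finset Filter Topology

namespace Literature.Probability.RandomPlanarGeometry.SAW.HV

/-! ### Statements -/

-- Face UB `RotByUnboundedLarge` (2 ≤ H) and `rotByUnboundedLarge_holds` are a-p2 g7's `HexSAWRotStripSurfaceZigzag.lean` (imported; no copy here).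

/-- **Proposition 11 at the strip level** (target): for `y > y†`, `W ↦ B^{→}_{H,W+1}(x_c; y)` is unbounded for all large `H`.
[cite: Beaton2014RotatedHoneycomb, §4, Proposition 11 (arXiv v3 p. 17; proof p. 18)] -/
def RotStripByUnbounded : Prop :=
  ∀ y : ℝ, rotYdagger < y → ∃ H₀ : ℕ, ∀ H ≥ H₀,
    ¬ BddAbove (Set.range fun Wd : ℕ => rotGFy ((rotStripV H (Wd + 1)).erase wOut) H (IsRotTopDart H) y)

/-- **Lemma 12 at the strip level** (target): for `0 < y < y†` and `H ≥ 1`, `W ↦ B^{→}_{H,W+1}(x_c; y)` is bounded.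
[cite: Beaton2014RotatedHoneycomb, §4, Lemma 12 (arXiv v3 p. 17)] -/
def RotStripByBounded : Prop :=
  ∀ (H : ℕ) (y : ℝ), 1 ≤ H → 0 < y → y < rotYdagger →
    BddAbove (Set.range fun Wd : ℕ => rotGFy ((rotStripV H (Wd + 1)).erase wOut) H (IsRotTopDart H) y)

/-- The strip-level core of Beaton's Theorem 1: Lemma 12 ∧ Proposition 11. [cite: Beaton2014RotatedHoneycomb, Theorem 1 (arXiv v3 p. 2), §4] -/
def BeatonYcCore : Prop := RotStripByBounded ∧ RotStripByUnbounded

/-- `b(y) := −c_B(y)` in the normalisation of a-p2's identity (`2·(cos(π/16) − corr(y))` after `rotB_coeff_eq`). [cite: Beaton2014RotatedHoneycomb, §4 (c_B(y), arXiv v3 p. 16)] -/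
def rotBneg (y : ℝ) : ℝ :=
  -(2 * ((Real.cos (Real.pi / 16) - hexCriticalFugacity ^ 2 * y ^ 2 * Real.cos (5 * Real.pi / 16)) /
    (hexCriticalFugacity * y * (1 + hexCriticalFugacity * y))))

/-! ### Elementary facts on the weighted classes -/

/-- Monotonicity of the `y`-weighted classes in `y ≥ 0`. [cite: Beaton2014RotatedHoneycomb, §3.2 (strip generating functions as series in y with nonnegative coefficients, arXiv v3 p. 15) and §4 (p. 16)] -/
theorem rotGFy_mono_y (V : Finset HV) (H : ℕ) (cls : HV × HV → Prop) [DecidablePred cls] {y y' : ℝ} (hy : 0 ≤ y)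
    (hyy' : y ≤ y') : rotGFy V H cls y ≤ rotGFy V H cls y' := by
  have hx : 0 < hexCriticalFugacity := hexCriticalFugacity_pos_lt_one.1
  unfold rotGFy
  exact sum_le_sum fun P _ => mul_le_mul_of_nonneg_left (pow_le_pow_left₀ hy hyy' _) (pow_nonneg hx.le _)

/-- **The interpolation (split) inequality**: for `0 ≤ t ≤ y`, `0 < y` and any `m₀`,
`G(t) ≤ max(1,t)^{m₀} · G(1) + (t/y)^{m₀} · G(y)` for every `y`-weighted class `G` (split the walks at `m₀` top contacts). [cite: Beaton2014RotatedHoneycomb, §3.2 (strip generating functions as series in y with nonnegative coefficients, arXiv v3 p. 15) and §4 (p. 16)] -/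
theorem rotGFy_le_split (V : Finset HV) (H : ℕ) (cls : HV × HV → Prop) [DecidablePred cls] {t y : ℝ} (ht : 0 ≤ t)
    (hty : t ≤ y) (hy : 0 < y) (m₀ : ℕ) :
    rotGFy V H cls t ≤ max 1 t ^ m₀ * rotGF V cls + (t / y) ^ m₀ * rotGFy V H cls y := by
  have hx : 0 < hexCriticalFugacity := hexCriticalFugacity_pos_lt_one.1
  have hr0 : 0 ≤ t / y := div_nonneg ht hy.le
  have hr1 : t / y ≤ 1 := (div_le_one hy).2 hty
  rw [← rotGFy_one V H cls]
  unfold rotGFy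
  rw [mul_sum, mul_sum, ← sum_add_distrib]
  refine sum_le_sum fun P _ => ?_
  have hxp : 0 ≤ hexCriticalFugacity ^ mwLen P := pow_nonneg hx.le _
  have h1 : 0 ≤ max 1 t ^ m₀ * (hexCriticalFugacity ^ mwLen P * 1 ^ topContacts H P) := by positivity
  have h2 : 0 ≤ (t / y) ^ m₀ * (hexCriticalFugacity ^ mwLen P * y ^ topContacts H P) :=
    mul_nonneg (pow_nonneg hr0 _) (mul_nonneg hxp (pow_nonneg hy.le _))
  rcases le_or_gt (topContacts H P) m₀ with hm | hm
  · have hle : t ^ topContacts H P ≤ max 1 t ^ m₀ :=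
      (pow_le_pow_left₀ ht (le_max_right 1 t) _).trans (pow_le_pow_right₀ (le_max_left 1 t) hm)
    calc hexCriticalFugacity ^ mwLen P * t ^ topContacts H P ≤ hexCriticalFugacity ^ mwLen P * max 1 t ^ m₀ :=
          mul_le_mul_of_nonneg_left hle hxp
      _ = max 1 t ^ m₀ * (hexCriticalFugacity ^ mwLen P * 1 ^ topContacts H P) := by rw [one_pow]; ring
      _ ≤ _ := le_add_of_nonneg_right h2
  · have hle : t ^ topContacts H P ≤ (t / y) ^ m₀ * y ^ topContacts H P := by
      have heq : t ^ topContacts H P = (t / y) ^ topContacts H P * y ^ topContacts H P := by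
        rw [← mul_pow, div_mul_cancel₀ t hy.ne']
      rw [heq]
      exact mul_le_mul_of_nonneg_right (pow_le_pow_of_le_one hr0 hr1 hm.le) (pow_nonneg hy.le _)
    calc hexCriticalFugacity ^ mwLen P * t ^ topContacts H P
        ≤ hexCriticalFugacity ^ mwLen P * ((t / y) ^ m₀ * y ^ topContacts H P) := mul_le_mul_of_nonneg_left hle hxp
      _ = (t / y) ^ m₀ * (hexCriticalFugacity ^ mwLen P * y ^ topContacts H P) := by ring
      _ ≤ _ := le_add_of_nonneg_left h1

/-! ### Lemma 12 (a-p2 g7's `rotGFy_top_le` by name) -/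

/-- **Lemma 12, strip level**: `W ↦ B^{→}_{H,W+1}(x_c; y)` is bounded for `0 < y < y†`. [cite: Beaton2014RotatedHoneycomb, §4, Lemma 12 (arXiv v3 p. 17)] -/
theorem rotTop_bddAbove_of_lt {H : ℕ} (hH : 1 ≤ H) {y : ℝ} (hy : 0 < y) (hlt : y < rotYdagger) :
    BddAbove (Set.range fun Wd : ℕ => rotGFy ((rotStripV H (Wd + 1)).erase wOut) H (IsRotTopDart H) y) := by
  refine ⟨hexCriticalFugacity * Real.cos (Real.pi / 16) * (hexCriticalFugacity * y * (1 + hexCriticalFugacity * y)) /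
      (Real.cos (Real.pi / 16) - hexCriticalFugacity ^ 2 * y ^ 2 * Real.cos (5 * Real.pi / 16)), ?_⟩
  rintro _ ⟨Wd, rfl⟩
  exact rotGFy_top_le hH hy hlt (Wd + 1)

/-- `RotStripByBounded` holds. [cite: Beaton2014RotatedHoneycomb, §4, Lemma 12] -/
theorem rotStripByBounded_holds : RotStripByBounded := fun _ _ hH hy hlt => rotTop_bddAbove_of_lt hH hy hlt

/-! ### The sign of `c_B(y)` and the identity bound on the lateral class -/

/-- For `y > y†` the `B`-coefficient is negative: `cos(π/16) − x_c² y² cos(5π/16) < 0`. [cite: Beaton2014RotatedHoneycomb, §4 (arXiv v3 p. 16: «c_B(y) … monotone decreasing …, c_B(y†) = 0»)] -/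
theorem rotB_num_neg_of_gt {y : ℝ} (hy : rotYdagger < y) :
    Real.cos (Real.pi / 16) - hexCriticalFugacity ^ 2 * y ^ 2 * Real.cos (5 * Real.pi / 16) < 0 := by
  have hy0 : 0 < y := rotYdagger_pos.trans hy
  obtain ⟨h1, h2⟩ := rotB_coeff_pos_iff hy0
  rcases lt_trichotomy (Real.cos (Real.pi / 16) - hexCriticalFugacity ^ 2 * y ^ 2 * Real.cos (5 * Real.pi / 16)) 0 with h | h | h
  · exact h
  · exact absurd (h2.1 h) (ne_of_gt hy)
  · exact absurd (h1.1 h) (not_lt.2 hy.le)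

/-- `b(y) > 0` for `y > y†`. [cite: Beaton2014RotatedHoneycomb, §4 (c_B(y) < 0 for y > y†, arXiv v3 p. 16)] -/
theorem rotBneg_pos {y : ℝ} (hy : rotYdagger < y) : 0 < rotBneg y := by
  have hx : 0 < hexCriticalFugacity := hexCriticalFugacity_pos_lt_one.1
  have hy0 : 0 < y := rotYdagger_pos.trans hy
  have hden : 0 < hexCriticalFugacity * y * (1 + hexCriticalFugacity * y) := by positivity
  rw [rotBneg, neg_pos]
  exact mul_neg_of_pos_of_neg two_pos (div_neg_of_neg_of_pos (rotB_num_neg_of_gt hy) hden)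

/-- **The identity bounds the lateral class when the top class is bounded** (`y > y†`, odd domains):
`c_E E^{⊥}_{H,W}(y) ≤ c_G + b(y)·K`. [cite: Beaton2014RotatedHoneycomb, §4, identity (21) at n = 0 (arXiv v3 p. 16)] -/
theorem rotLat_le_of_top_le {H Wd : ℕ} (hH : 1 ≤ H) (hW : 1 ≤ Wd) (hodd : Odd (H + Wd)) {y K : ℝ} (hy : rotYdagger < y)
    (hK : rotGFy ((rotStripV H Wd).erase wOut) H (IsRotTopDart H) y ≤ K) :
    2 * Real.cos (3 * Real.pi / 16) * rotGFy ((rotStripV H Wd).erase wOut) H (IsRotLatDart H Wd) y ≤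
      2 * hexCriticalFugacity * Real.cos (Real.pi / 16) + rotBneg y * K := by
  have hy0 : 0 < y := rotYdagger_pos.trans hy
  have hid := rotStrip_identityY (H := H) (Wd := Wd) hH hW hodd hy0
  rw [rotB_coeff_eq hy0] at hid
  set b : ℝ := rotBneg y with hbdef
  have hb : 0 < b := rotBneg_pos hy
  have hcB : 2 * ((Real.cos (Real.pi / 16) - hexCriticalFugacity ^ 2 * y ^ 2 * Real.cos (5 * Real.pi / 16)) /
      (hexCriticalFugacity * y * (1 + hexCriticalFugacity * y))) = -b := by rw [hbdef, rotBneg, neg_neg]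
  rw [hcB] at hid
  have hs3 : 0 < Real.sin (3 * Real.pi / 16) :=
    Real.sin_pos_of_pos_of_lt_pi (by positivity) (by linarith [Real.pi_pos])
  have hs1 : 0 < Real.sin (Real.pi / 16) :=
    Real.sin_pos_of_pos_of_lt_pi (by positivity) (by linarith [Real.pi_pos])
  have hc7 : 0 < Real.cos (7 * Real.pi / 16) :=
    Real.cos_pos_of_mem_Ioo ⟨by linarith [Real.pi_pos], by linarith [Real.pi_pos]⟩
  have hO := mul_nonneg (mul_pos two_pos hs3).le (rotGFy_nonneg ((rotStripV H Wd).erase wOut) H IsRotBotOut hy0.le)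
  have hI := mul_nonneg (mul_pos two_pos hs1).le (rotGFy_nonneg ((rotStripV H Wd).erase wOut) H IsRotBotIn hy0.le)
  have hP := mul_nonneg (mul_pos two_pos hc7).le (rotGFy_nonneg ((rotStripV H Wd).erase wOut) H IsRotCloseDart hy0.le)
  have hBK := mul_le_mul_of_nonneg_left hK hb.le
  linarith

/-- **THE LANE'S INTERPOLATION LEMMA (replaces Beaton's Cor. 10/13 input)**: if the top class `B^{→}_{H,W_m}(x_c; y)` is bounded along
odd domains `D(H, W_m)`, `W_m → ∞`, with `y > y†`, then for every `0 ≤ t < y` the lateral class `E^{⊥}_{H,W_m}(x_c; t) → 0` —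
from `rotGFy_le_split`, a-p6's `tendsto_rotStripLat_zero` (the case `y = 1`) and `rotLat_le_of_top_le`. [cite: Beaton2014RotatedHoneycomb, §4, Corollary 13 (arXiv v3 p. 17) — the lane's substitute for its proof via Corollary 10] -/
theorem tendsto_rotLat_of_top_bdd {H : ℕ} (hH : 1 ≤ H) {t y K : ℝ} (ht : 0 ≤ t) (hty : t < y) (hy : rotYdagger < y)
    {W : ℕ → ℕ} (hW : Tendsto W atTop atTop) (hW1 : ∀ m, 1 ≤ W m) (hodd : ∀ m, Odd (H + W m))
    (hK : ∀ m, rotGFy ((rotStripV H (W m)).erase wOut) H (IsRotTopDart H) y ≤ K) :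
    Tendsto (fun m => rotGFy ((rotStripV H (W m)).erase wOut) H (IsRotLatDart H (W m)) t) atTop (𝓝 0) := by
  have hy0 : 0 < y := rotYdagger_pos.trans hy
  have hc3 : 0 < Real.cos (3 * Real.pi / 16) :=
    Real.cos_pos_of_mem_Ioo ⟨by linarith [Real.pi_pos], by linarith [Real.pi_pos]⟩
  set M : ℝ := (2 * hexCriticalFugacity * Real.cos (Real.pi / 16) + rotBneg y * K) / (2 * Real.cos (3 * Real.pi / 16)) with hM
  have hEM : ∀ m, rotGFy ((rotStripV H (W m)).erase wOut) H (IsRotLatDart H (W m)) y ≤ M := by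
    intro m
    rw [hM, le_div_iff₀ (mul_pos two_pos hc3)]
    have h := rotLat_le_of_top_le hH (hW1 m) (hodd m) hy (hK m)
    linarith
  have hr0 : 0 ≤ t / y := div_nonneg ht hy0.le
  have hr1 : t / y < 1 := (div_lt_one hy0).2 hty
  have h1 : Tendsto (fun m => rotGF ((rotStripV H (W m)).erase wOut) (IsRotLatDart H (W m))) atTop (𝓝 0) :=
    (tendsto_rotStripLat_zero hH).comp hW
  rw [Metric.tendsto_atTop]
  intro ε hε
  have hpow : Tendsto (fun n : ℕ => (t / y) ^ n * M) atTop (𝓝 0) := by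
    simpa using (tendsto_pow_atTop_nhds_zero_of_lt_one hr0 hr1).mul_const M
  obtain ⟨m₀, hm₀⟩ := (hpow.eventually (gt_mem_nhds (half_pos hε))).exists
  have hmax : Tendsto (fun m => max 1 t ^ m₀ * rotGF ((rotStripV H (W m)).erase wOut) (IsRotLatDart H (W m))) atTop (𝓝 0) := by
    simpa using h1.const_mul (max 1 t ^ m₀)
  obtain ⟨N, hN⟩ := eventually_atTop.1 (hmax.eventually (gt_mem_nhds (half_pos hε)))
  refine ⟨N, fun m hm => ?_⟩
  rw [Real.dist_eq, sub_zero, abs_of_nonneg (rotGFy_nonneg _ _ _ ht)]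
  have hsplit := rotGFy_le_split ((rotStripV H (W m)).erase wOut) H (IsRotLatDart H (W m)) ht hty.le hy0 m₀
  have h2 : (t / y) ^ m₀ * rotGFy ((rotStripV H (W m)).erase wOut) H (IsRotLatDart H (W m)) y ≤ (t / y) ^ m₀ * M :=
    mul_le_mul_of_nonneg_left (hEM m) (pow_nonneg hr0 _)
  linarith [hN m hm]

/-! ### Proposition 11, unconditionally -/

/-- T3 in limit form: `sup_W B^{→}_{H,W}(x_c) → 0` as `H → ∞` (tree `iSup_rotStripBR_le_log`). [cite: Beaton2014RotatedHoneycomb, §4 (arXiv v3 p. 17: "The result that B(x_c,1) = 0 (Corollary 15) is proved in the appendix") with Appendix Corollary 15 (p. 19)] -/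
theorem tendsto_iSup_rotStripBR : Tendsto (fun H : ℕ => ⨆ Wd : ℕ, rotStripBR H Wd) atTop (𝓝 0) := by
  obtain ⟨C, hC⟩ := iSup_rotStripBR_le_log
  have h1 : Tendsto (fun x : ℝ => x ^ (-(1 / 3 : ℝ))) atTop (𝓝 0) := tendsto_rpow_neg_atTop (by norm_num)
  have h2 := h1.comp (Real.tendsto_log_atTop.comp tendsto_natCast_atTop_atTop)
  have hlog : Tendsto (fun H : ℕ => Real.log H ^ (-(1 : ℝ) / 3)) atTop (𝓝 0) := by
    refine h2.congr' (Eventually.of_forall fun H => ?_)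
    simp only [Function.comp_apply]
    norm_num
  have hup : Tendsto (fun H : ℕ => C * Real.log H ^ (-(1 : ℝ) / 3)) atTop (𝓝 0) := by
    simpa using hlog.const_mul C
  refine squeeze_zero' (Eventually.of_forall fun H => Real.iSup_nonneg fun Wd => rotStripBR_nonneg H Wd) ?_ hup
  exact Filter.eventually_atTop.2 ⟨2, fun H hH => hC H hH⟩

/-- **Proposition 11 (Beaton §4, statement p. 17, proof p. 18; made finite), NO hypothesis.**  For `y > y†` put `t := (y† + y)/2`, `b := b(t) > 0`,
`σ := 2sin(3π/16)+2sin(π/16)+2cos(7π/16)`; on the odd domains `D(H+1,W)` the identity Y1 at `t`, the `y = 1` identity of `D(H,W)` and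
the cut Y2 give `2cos(π/16)·B^{→}_{H,W}(1) ≤ (σ x_c⁻¹ sup_{W′} B^{→}_{H,W′} − b)·B^{→}_{H+1,W}(t) + 2cos(3π/16)·E^{⊥}_{H+1,W}(t)`; for
`H ≥ H₀(t)` (T3: the sup is `< b x_c/(2σ)`) the first term is `≤ 0`; if `W ↦ B^{→}_{H+1,W}(y)` were bounded, then along odd `W → ∞`
`E^{⊥}_{H+1,W}(t) → 0` (interpolation lemma) while `B^{→}_{H,W}(1) → sup > 0` (tree `tendsto_rotStripBR`, S0): contradiction.
[cite: Beaton2014RotatedHoneycomb, §4, Proposition 11 (arXiv v3 p. 17) and its proof (p. 18: "Any walk counted by Â°_{T+1}(x_c; y) which has contacts with the top boundary can be factored into two pieces by cutting it at the mid-edge immediately following its last surface contact", Fig. 7 — the rotated last-contact cut, consumed here through a-p6's `HV.rot_arch_cut_iSup`)] -/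
theorem rotStripByUnbounded_holds : RotStripByUnbounded := by
  intro y hy
  have hx : 0 < hexCriticalFugacity := hexCriticalFugacity_pos_lt_one.1
  -- the contradiction is run at the midpoint `t ∈ (y†, y)`
  set t : ℝ := (rotYdagger + y) / 2 with htdef
  have ht : rotYdagger < t := by rw [htdef]; linarith
  have hty : t < y := by rw [htdef]; linarith
  have ht0 : 0 < t := rotYdagger_pos.trans ht
  have hden : 0 < hexCriticalFugacity * t * (1 + hexCriticalFugacity * t) := by positivity
  set b : ℝ := rotBneg t with hbdef
  have hb : 0 < b := rotBneg_pos ht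
  have hs3 : 0 < Real.sin (3 * Real.pi / 16) :=
    Real.sin_pos_of_pos_of_lt_pi (by positivity) (by linarith [Real.pi_pos])
  have hs1 : 0 < Real.sin (Real.pi / 16) :=
    Real.sin_pos_of_pos_of_lt_pi (by positivity) (by linarith [Real.pi_pos])
  have hc1 : 0 < Real.cos (Real.pi / 16) :=
    Real.cos_pos_of_mem_Ioo ⟨by linarith [Real.pi_pos], by linarith [Real.pi_pos]⟩
  have hc3 : 0 < Real.cos (3 * Real.pi / 16) :=
    Real.cos_pos_of_mem_Ioo ⟨by linarith [Real.pi_pos], by linarith [Real.pi_pos]⟩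
  have hc7 : 0 < Real.cos (7 * Real.pi / 16) :=
    Real.cos_pos_of_mem_Ioo ⟨by linarith [Real.pi_pos], by linarith [Real.pi_pos]⟩
  set σ : ℝ := 2 * Real.sin (3 * Real.pi / 16) + 2 * Real.sin (Real.pi / 16) + 2 * Real.cos (7 * Real.pi / 16) with hσdef
  have hσ : 0 < σ := by rw [hσdef]; linarith
  set c : ℝ := hexCriticalFugacity⁻¹ with hcdef
  have hc : 0 < c := inv_pos.2 hx
  -- T3: `sup_W B^{→}_{H,W} → 0`, hence eventually below `b / (2 σ c)`
  have hsmall : ∀ᶠ H : ℕ in atTop, (⨆ Wd : ℕ, rotStripBR H Wd) < b / (2 * σ * c) :=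
    tendsto_iSup_rotStripBR.eventually (gt_mem_nhds (by positivity))
  obtain ⟨H₀, hH₀⟩ := Filter.eventually_atTop.1 hsmall
  refine ⟨H₀ + 2, fun H' hH' hbdd => ?_⟩
  obtain ⟨H, rfl⟩ : ∃ H, H' = H + 1 := ⟨H' - 1, by omega⟩
  have hH : 1 ≤ H := by omega
  have hBH : σ * c * (⨆ Wd : ℕ, rotStripBR H Wd) ≤ b / 2 := by
    have h := (hH₀ H (by omega)).le
    have hσc : 0 < σ * c := mul_pos hσ hc
    calc σ * c * (⨆ Wd : ℕ, rotStripBR H Wd) ≤ σ * c * (b / (2 * σ * c)) := mul_le_mul_of_nonneg_left h hσc.le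
      _ = b / 2 := by field_simp
  obtain ⟨K, hK⟩ := hbdd
  have hKW : ∀ Wd : ℕ, 1 ≤ Wd → rotGFy ((rotStripV (H + 1) Wd).erase wOut) (H + 1) (IsRotTopDart (H + 1)) y ≤ K := by
    intro Wd hWd
    refine hK ⟨Wd - 1, ?_⟩
    show rotGFy ((rotStripV (H + 1) (Wd - 1 + 1)).erase wOut) (H + 1) (IsRotTopDart (H + 1)) y =
      rotGFy ((rotStripV (H + 1) Wd).erase wOut) (H + 1) (IsRotTopDart (H + 1)) y
    rw [Nat.sub_add_cancel hWd]
  -- boundedness at `y` gives boundedness at `t ≤ y`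
  have hKWt : ∀ Wd : ℕ, 1 ≤ Wd → rotGFy ((rotStripV (H + 1) Wd).erase wOut) (H + 1) (IsRotTopDart (H + 1)) t ≤ K :=
    fun Wd hWd => (rotGFy_mono_y _ _ _ ht0.le hty.le).trans (hKW Wd hWd)
  -- the key inequality on the odd domains `D(H+1,W)`, at `t`
  have hlow : ∀ Wd : ℕ, 1 ≤ Wd → Odd (H + 1 + Wd) →
      2 * Real.cos (Real.pi / 16) * rotStripBR H Wd ≤
        2 * Real.cos (3 * Real.pi / 16) *
          rotGFy ((rotStripV (H + 1) Wd).erase wOut) (H + 1) (IsRotLatDart (H + 1) Wd) t := by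
    intro Wd hWd hodd
    have hid := rotStrip_identityY (H := H + 1) (Wd := Wd) (by omega) hWd hodd ht0
    rw [rotB_coeff_eq ht0] at hid
    have hid0 := rotStrip_identity (H := H) (Wd := Wd) hH hWd
    have hcut := rot_arch_cut_iSup (H := H) hH Wd ht0.le
    dsimp only at hcut
    obtain ⟨hcO, hcI, hcP⟩ := hcut
    rw [← rotStripBR_eq_rotGF H Wd] at hid0
    have hT0 : 0 ≤ rotGFy ((rotStripV (H + 1) Wd).erase wOut) (H + 1) (IsRotTopDart (H + 1)) t :=
      rotGFy_nonneg _ _ _ ht0.le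
    have hLat0 : 0 ≤ rotGF ((rotStripV H Wd).erase wOut) (IsRotLatDart H Wd) := rotStripLat_nonneg H Wd
    have h4 := mul_le_mul_of_nonneg_right hBH hT0
    have h5 := mul_le_mul_of_nonneg_left hcO (mul_pos two_pos hs3).le
    have h6 := mul_le_mul_of_nonneg_left hcI (mul_pos two_pos hs1).le
    have h7 := mul_le_mul_of_nonneg_left hcP (mul_pos two_pos hc7).le
    have hcB : 2 * ((Real.cos (Real.pi / 16) - hexCriticalFugacity ^ 2 * t ^ 2 * Real.cos (5 * Real.pi / 16)) /
        (hexCriticalFugacity * t * (1 + hexCriticalFugacity * t))) = -b := by rw [hbdef, rotBneg, neg_neg]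
    rw [hcB] at hid
    have hσT : σ * c * (⨆ Wd : ℕ, rotStripBR H Wd) * rotGFy ((rotStripV (H + 1) Wd).erase wOut) (H + 1) (IsRotTopDart (H + 1)) t =
        2 * Real.sin (3 * Real.pi / 16) * (c * rotGFy ((rotStripV (H + 1) Wd).erase wOut) (H + 1) (IsRotTopDart (H + 1)) t *
            (⨆ Wd : ℕ, rotStripBR H Wd)) +
          2 * Real.sin (Real.pi / 16) * (c * rotGFy ((rotStripV (H + 1) Wd).erase wOut) (H + 1) (IsRotTopDart (H + 1)) t *
            (⨆ Wd : ℕ, rotStripBR H Wd)) +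
          2 * Real.cos (7 * Real.pi / 16) * (c * rotGFy ((rotStripV (H + 1) Wd).erase wOut) (H + 1) (IsRotTopDart (H + 1)) t *
            (⨆ Wd : ℕ, rotStripBR H Wd)) := by
      rw [hσdef]; ring
    linarith [mul_nonneg hb.le hT0, mul_nonneg hc3.le hLat0, h4, h5, h6, h7, hid, hid0, hσT]
  -- `W → ∞` along the right parity: `E^{⊥}(t) → 0` (interpolation lemma) but `B^{→}_{H,W}(1) → sup > 0` (tree + S0)
  have hBpos : 0 < ⨆ Wd : ℕ, rotStripBR H Wd := iSup_rotStripBR_pos hH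
  obtain ⟨r, hr⟩ : ∃ r : ℕ, ∀ m : ℕ, 1 ≤ 2 * m + r ∧ Odd (H + 1 + (2 * m + r)) := by
    rcases Nat.even_or_odd H with ⟨k, hk⟩ | ⟨k, hk⟩
    · exact ⟨2, fun m => ⟨by omega, ⟨k + m + 1, by omega⟩⟩⟩
    · exact ⟨1, fun m => ⟨by omega, ⟨k + m + 1, by omega⟩⟩⟩
  have hφ : Tendsto (fun m : ℕ => 2 * m + r) atTop atTop :=
    tendsto_atTop_mono (fun m => show m ≤ 2 * m + r by omega) tendsto_id
  have hE' : Tendsto (fun m : ℕ =>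
      rotGFy ((rotStripV (H + 1) (2 * m + r)).erase wOut) (H + 1) (IsRotLatDart (H + 1) (2 * m + r)) t) atTop (𝓝 0) :=
    tendsto_rotLat_of_top_bdd (H := H + 1) (W := fun m => 2 * m + r) (by omega) ht0.le hty hy hφ
      (fun m => (hr m).1) (fun m => (hr m).2) (fun m => hKW _ (hr m).1)
  have hB' : Tendsto (fun m : ℕ => rotStripBR H (2 * m + r)) atTop (𝓝 (⨆ Wd : ℕ, rotStripBR H Wd)) :=
    (tendsto_rotStripBR hH).comp hφ
  have hthr : (0 : ℝ) < Real.cos (Real.pi / 16) * (⨆ Wd : ℕ, rotStripBR H Wd) / (2 * Real.cos (3 * Real.pi / 16)) :=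
    div_pos (mul_pos hc1 hBpos) (mul_pos two_pos hc3)
  have hev1 := hE'.eventually_lt_const hthr
  have hev2 := hB'.eventually_const_lt (half_lt_self hBpos)
  obtain ⟨m, hm1, hm2⟩ := (hev1.and hev2).exists
  have hkey := hlow (2 * m + r) (hr m).1 (hr m).2
  have h8 : 2 * Real.cos (3 * Real.pi / 16) *
      rotGFy ((rotStripV (H + 1) (2 * m + r)).erase wOut) (H + 1) (IsRotLatDart (H + 1) (2 * m + r)) t <
        Real.cos (Real.pi / 16) * (⨆ Wd : ℕ, rotStripBR H Wd) := by
    have := mul_lt_mul_of_pos_left hm1 (mul_pos two_pos hc3)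
    calc 2 * Real.cos (3 * Real.pi / 16) *
          rotGFy ((rotStripV (H + 1) (2 * m + r)).erase wOut) (H + 1) (IsRotLatDart (H + 1) (2 * m + r)) t
        < 2 * Real.cos (3 * Real.pi / 16) *
          (Real.cos (Real.pi / 16) * (⨆ Wd : ℕ, rotStripBR H Wd) / (2 * Real.cos (3 * Real.pi / 16))) := this
      _ = Real.cos (Real.pi / 16) * (⨆ Wd : ℕ, rotStripBR H Wd) := by field_simp
  have h9 := mul_lt_mul_of_pos_left hm2 (mul_pos two_pos hc1)
  linarith

/-- **Proposition 11, strip level** (pointwise form): for `y > y†`, `∃ H₀, ∀ H ≥ H₀`, `W ↦ B^{→}_{H,W+1}(x_c; y)` is unbounded.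
[cite: Beaton2014RotatedHoneycomb, §4, Proposition 11 (arXiv v3 p. 17; proof p. 18)] -/
theorem rotTop_not_bddAbove_of_gt {y : ℝ} (hy : rotYdagger < y) :
    ∃ H₀ : ℕ, ∀ H ≥ H₀, ¬ BddAbove (Set.range fun Wd : ℕ => rotGFy ((rotStripV H (Wd + 1)).erase wOut) H (IsRotTopDart H) y) :=
  rotStripByUnbounded_holds y hy

/-- **The core of Beaton's Theorem 1 at the strip level: Lemma 12 ∧ Proposition 11 — UNCONDITIONAL.** [cite: Beaton2014RotatedHoneycomb, Theorem 1, §4 (Lemma 12, Proposition 11)] -/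
theorem beatonYcCore_holds : BeatonYcCore := ⟨rotStripByBounded_holds, rotStripByUnbounded_holds⟩

/-! ### The lane thresholds `y_H` and the capstone `y_H → y†` -/

/-- The fugacities `y ≥ 0` at which `W ↦ B^{→}_{H,W+1}(x_c; y)` stays bounded. [cite: Beaton2014RotatedHoneycomb, §3.2 (strip generating functions and their radius y_T, Corollary 10, arXiv v3 p. 15)] -/
def rotBddSet (H : ℕ) : Set ℝ :=
  {y : ℝ | 0 ≤ y ∧ BddAbove (Set.range fun Wd : ℕ => rotGFy ((rotStripV H (Wd + 1)).erase wOut) H (IsRotTopDart H) y)}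

/-- **`y_H` (LANE DEFINITION, rotated frame)**: `sup {y ≥ 0 : sup_W B^{→}_{H,W+1}(x_c; y) < ∞}` — the lane's stand-in for Beaton's strip
critical fugacity `y_T` (NOT identified with it here; junk for `H ≤ 1`, where the set is unbounded). [cite: Beaton2014RotatedHoneycomb, §3.2, Corollary 10 (arXiv v3 p. 15)] -/
def rotYT (H : ℕ) : ℝ := sSup (rotBddSet H)

/-- UB in the `rotGFy` spelling (a-p2's `rotStripBRy H Wd y` unfolds to it). [cite: Beaton2014RotatedHoneycomb, §3, Proposition 7 (arXiv v3 p. 11)] -/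
theorem rotTop_not_bddAbove_large {H : ℕ} (hH : 2 ≤ H) {y : ℝ} (hy : 2 + Real.sqrt 2 < y) :
    ¬ BddAbove (Set.range fun Wd : ℕ => rotGFy ((rotStripV H (Wd + 1)).erase wOut) H (IsRotTopDart H) y) :=
  rotByUnboundedLarge_holds H y hH hy

/-- The bounded set lies below `2 + √2` for `H ≥ 2` (UB). [cite: Beaton2014RotatedHoneycomb, §3, Proposition 7] -/
theorem rotBddSet_bddAbove {H : ℕ} (hH : 2 ≤ H) : BddAbove (rotBddSet H) :=
  ⟨2 + Real.sqrt 2, fun _ hy => not_lt.1 fun h => rotTop_not_bddAbove_large hH h hy.2⟩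

/-- «`B^{→}_H(x_c; y)` bounded ⇒ `y ≤ y_H`» (`H ≥ 2`). [cite: Beaton2014RotatedHoneycomb, §3.2] -/
theorem le_rotYT {H : ℕ} (hH : 2 ≤ H) {y : ℝ} (hy : 0 ≤ y)
    (hb : BddAbove (Set.range fun Wd : ℕ => rotGFy ((rotStripV H (Wd + 1)).erase wOut) H (IsRotTopDart H) y)) : y ≤ rotYT H :=
  le_csSup (rotBddSet_bddAbove hH) ⟨hy, hb⟩

/-- «`B^{→}_H(x_c; y)` unbounded ⇒ `y_H ≤ y`». [cite: Beaton2014RotatedHoneycomb, §3.2] -/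
theorem rotYT_le {H : ℕ} (hne : (rotBddSet H).Nonempty) {y : ℝ} (hy : 0 ≤ y)
    (hnb : ¬ BddAbove (Set.range fun Wd : ℕ => rotGFy ((rotStripV H (Wd + 1)).erase wOut) H (IsRotTopDart H) y)) :
    rotYT H ≤ y := by
  refine csSup_le hne fun y' hy' => ?_
  by_contra h
  push Not at h
  obtain ⟨K, hK⟩ := hy'.2
  exact hnb ⟨K, by
    rintro _ ⟨Wd, rfl⟩
    exact (rotGFy_mono_y _ H _ hy h.le).trans (hK ⟨Wd, rfl⟩)⟩

/-- Below `y†` every `y > 0` is in the bounded set (Lemma 12). [cite: Beaton2014RotatedHoneycomb, §4, Lemma 12] -/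
theorem mem_rotBddSet_of_lt {H : ℕ} (hH : 1 ≤ H) {y : ℝ} (hy : 0 < y) (hyD : y < rotYdagger) : y ∈ rotBddSet H :=
  ⟨hy.le, rotTop_bddAbove_of_lt hH hy hyD⟩

/-- `y† ≤ y_H` for every `H ≥ 2` (Lemma 12 + UB). [cite: Beaton2014RotatedHoneycomb, §4, Lemma 12 («y_c ≥ y†»)] -/
theorem rotYdagger_le_rotYT {H : ℕ} (hH : 2 ≤ H) : rotYdagger ≤ rotYT H := by
  refine le_of_not_gt fun hlt => ?_
  set c : ℝ := (max (rotYT H) 0 + rotYdagger) / 2 with hc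
  have hmax : max (rotYT H) 0 < rotYdagger := max_lt hlt rotYdagger_pos
  have hc0 : 0 < c := by rw [hc]; linarith [le_max_right (rotYT H) 0]
  have hcD : c < rotYdagger := by rw [hc]; linarith
  have hcY : rotYT H < c := by rw [hc]; linarith [le_max_left (rotYT H) 0]
  have hmem := mem_rotBddSet_of_lt (H := H) (by omega) hc0 hcD
  exact absurd (le_rotYT hH hc0.le hmem.2) (not_le.2 hcY)

/-- For `y > y†` and `H` large, `y_H ≤ y` (Proposition 11) — no hypothesis. [cite: Beaton2014RotatedHoneycomb, §4, Proposition 11] -/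
theorem rotYT_le_of_gt {y : ℝ} (hy : rotYdagger < y) : ∀ᶠ H : ℕ in atTop, rotYT H ≤ y := by
  obtain ⟨H₀, hH₀⟩ := rotStripByUnbounded_holds y hy
  refine eventually_atTop.2 ⟨max H₀ 1, fun H hH => ?_⟩
  have hne : (rotBddSet H).Nonempty :=
    ⟨rotYdagger / 2, mem_rotBddSet_of_lt (le_of_max_le_right hH) (half_pos rotYdagger_pos) (half_lt_self rotYdagger_pos)⟩
  exact rotYT_le hne (rotYdagger_pos.trans hy).le (hH₀ H (le_of_max_le_left hH))

/-- **CAPSTONE (rotated frame, strip level): `y_H → y†`, UNCONDITIONAL** (`y† = √((2+√2)/(1+√2−√(2+√2)))` by a-p2's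
`rotYdagger_eq_printed`). [cite: Beaton2014RotatedHoneycomb, Theorem 1 with §3.2 Corollary 10 («y_T decreases to y_c») — strip-level analogue] -/
theorem tendsto_rotYT : Tendsto rotYT atTop (𝓝 rotYdagger) := by
  rw [tendsto_order]
  refine ⟨fun a ha => eventually_atTop.2 ⟨2, fun H hH => lt_of_lt_of_le ha (rotYdagger_le_rotYT hH)⟩, fun b hb => ?_⟩
  obtain ⟨y, hy1, hy2⟩ := exists_between hb
  exact (rotYT_le_of_gt hy1).mono fun H hH => lt_of_le_of_lt hH hy2

end Literature.Probability.RandomPlanarGeometry.SAW.HV
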